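import Summits.PneNP.PneNP.Theorems.SymmetryBudgetNoHiddenOrderValueGadgetsDefs
import Summits.PneNP.PneNP.Theorems.SymmetryBudgetNoHiddenOrderKitBridges
import Summits.PneNP.PneNP.Theorems.SymmetryBudgetNoHiddenOrderReplayIterStages
import Summits.PneNP.PneNP.Theorems.SymmetryBudgetNoHiddenOrderPerPathRefineRank

/-!
# `NoHiddenOrder` (stmt-PneNP-14781), (R2c) value layer III: semantics of the three composite gadgets

Route `PneNP/SymmetryBudget`; definitions in `SymmetryBudgetNoHiddenOrderValueGadgetsDefs.lean`.

* `Comps.sem_r_iff_swReach` — with membership wires reading `B`, adjacency reading `G` and kernel wires reading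
  `col` on `B` (`|B|² ≤ N`, `|B| ≤ T`): `R.r (Fin.last T) u w` reads `u ∈ B ∧ w ∈ swReach G B col u`;
* `ValOrd.sem_lt_iff` / `sem_eq_iff` — order and kernel of `f` from its one-hot value wires (`f < D`);
* `RefVal.sem_val_iff` — with the block `A` (`|A| ≤ N`, `|A| ≤ T + 1`), the graph and the initial colouring read, the
  value wire `val v t` reads `refineIn G A col₀ v = t` for EVERY vertex `v` (a `refineIn` value counts the block
  vertices below it, `BranchSum.refineIn_eq_card_lt` of `…PerPathRefineRank`; it vanishes off the block); also the final order/kernel wires read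
  `refineIn` on the block (`sem_ltL_iff`, `sem_eqL_iff`).
Sorry-free; supports stmt-PneNP-14781.
-/

set_option linter.dupNamespace false -- `Summit.PneNP.PneNP.…` (D-0017 single-conjunct layout)

namespace Summit.PneNP.PneNP.Theorems

open Finset Literature.Computability.Complexity Literature.Computability.Complexity.SymProg
open Literature.Combinatorics.SimpleGraph (ocrIter ocrStep KeyLT)

variable {ι Λ : Type*} [DecidableEq ι] [DecidableEq Λ] {P : SymProg ι Λ}
variable {V : Type*} [Fintype V] [DecidableEq V] {N T D : ℕ} {x : ι → Bool}
variable {G : SimpleGraph V} [DecidableRel G.Adj]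

/-! ### Switching components -/

namespace Comps

variable (C : Comps P V N T)

/-- **The reachability wires read the switching components**: if the membership wires read `B`, the adjacency
wires `G` and the kernel wires `col` on `B`, then `R.r (Fin.last T) u w` reads `u ∈ B ∧ w ∈ swReach G B col u`.
[folklore] -/
theorem sem_r_iff_swReach {B : Finset V} {col : V → ℕ}
    (hmem : ∀ u, wval x (P.sem x) (C.S.mem u) = true ↔ u ∈ B)
    (hadj : ∀ a b, wval x (P.sem x) (C.S.adj a b) = true ↔ G.Adj a b)
    (heq : ∀ a ∈ B, ∀ b ∈ B, wval x (P.sem x) (C.S.eq a b) = true ↔ col a = col b)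
    (hN : B.card ^ 2 ≤ N) (hT : B.card ≤ T) (u w : V) :
    P.sem x (C.R.r (Fin.last T) u w) = true ↔ u ∈ B ∧ w ∈ BranchSum.swReach G B col u := by
  classical
  set S := C.S with hS
  set R := C.R with hR
  have hpart : S.part x = B := by
    ext v; rw [S.mem_part]; exact hmem v
  have hreads : S.Reads x (G.induce ((S.part x : Finset V) : Set V)) (fun a => col a) :=
    { adj_iff := fun a b => hadj a b
      eq_iff := fun a b => heq a (hpart ▸ a.2) b (hpart ▸ b.2) }
  have hNS : (S.part x).card ^ 2 ≤ N := by rw [hpart]; exact hN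
  have hsw : ∀ {a b : V} (ha : a ∈ B) (hb : b ∈ B),
      P.sem x (S.sw a b) = true ↔ (BranchSum.swGraph G B col).Adj a b := by
    intro a b ha hb
    have ha' : a ∈ S.part x := hpart ▸ ha
    have hb' : b ∈ S.part x := hpart ▸ hb
    rw [Switching.sem_sw_iff hreads hNS ⟨a, ha'⟩ ⟨b, hb'⟩, ← hpart]
    exact (BranchSum.swGraph_adj_iff_induce (G := G) (S.part x) col ha' hb').symm
  have hRmem : ∀ v, R.Mem x v ↔ v ∈ B := by
    intro v; show wval x (P.sem x) (R.mem v) = true ↔ _; rw [show R.mem v = S.mem v from C.R_mem v]; exact hmem v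
  have hEx : ∀ a b, R.Ex x a b ↔ (a ∈ B ∧ b ∈ B ∧ (BranchSum.swGraph G B col).Adj a b) := by
    intro a b
    show R.Mem x a ∧ R.Mem x b ∧ wval x (P.sem x) (R.edge a b) = true ↔ _
    rw [hRmem, hRmem, show R.edge a b = Sum.inr (S.sw a b) from C.R_edge a b, wval_inr]
    constructor
    · rintro ⟨ha, hb, hs⟩; exact ⟨ha, hb, (hsw ha hb).1 hs⟩
    · rintro ⟨ha, hb, hs⟩; exact ⟨ha, hb, (hsw ha hb).2 hs⟩
  have hExEq : R.Ex x = fun a b => a ∈ B ∧ b ∈ B ∧ (BranchSum.swGraph G B col).Adj a b :=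
    funext fun a => funext fun b => propext (hEx a b)
  have hTR : (univ.filter fun v => R.Mem x v).card ≤ T := by
    have : (univ.filter fun v => R.Mem x v) = B := by
      ext v; simp only [mem_filter, mem_univ, true_and, hRmem]
    exact (congrArg Finset.card this).trans_le hT
  rw [Reach.sem_r_last_iff (R := R) (x := x) hTR, hRmem, hExEq]
  by_cases hu : u ∈ B
  · rw [BranchSum.mem_swReach_iff_reflTransGen col hu]
  · simp [hu]

end Comps

/-! ### Order and kernel from one-hot values -/

namespace ValOrd

variable (O : ValOrd P V D)

omit [Fintype V] [DecidableEq V] in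
/-- The pair gates. [folklore] -/
theorem sem_pr {f : V → ℕ} (hval : ∀ u (c : Fin D), wval x (P.sem x) (O.val u c) = true ↔ f u = c) (u v : V) (c c' : Fin D) :
    P.sem x (O.pr u v c c') = true ↔ f u = c ∧ f v = c' := by
  rw [P.sem_and (O.kind_pr u v c c'), O.srcs_pr]
  simp only [mem_insert, mem_singleton, forall_eq_or_imp, forall_eq, hval]

omit [Fintype V] [DecidableEq V] in
/-- **The order wires.** [folklore] -/
theorem sem_lt_iff {f : V → ℕ} (hval : ∀ u (c : Fin D), wval x (P.sem x) (O.val u c) = true ↔ f u = c)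
    (hf : ∀ u, f u < D) (u v : V) : P.sem x (O.lt u v) = true ↔ f u < f v := by
  rw [P.sem_or (O.kind_lt u v), O.srcs_lt]
  simp only [mem_image, mem_filter, mem_univ, true_and, Prod.exists]
  constructor
  · rintro ⟨_, ⟨c, c', hlt, rfl⟩, hw⟩
    rw [wval_inr, O.sem_pr hval] at hw
    rw [hw.1, hw.2]; exact hlt
  · intro hlt
    refine ⟨_, ⟨⟨f u, hf u⟩, ⟨f v, hf v⟩, hlt, rfl⟩, ?_⟩
    rw [wval_inr, O.sem_pr hval]
    exact ⟨rfl, rfl⟩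

omit [Fintype V] [DecidableEq V] in
/-- **The kernel wires.** [folklore] -/
theorem sem_eq_iff {f : V → ℕ} (hval : ∀ u (c : Fin D), wval x (P.sem x) (O.val u c) = true ↔ f u = c)
    (hf : ∀ u, f u < D) (u v : V) : P.sem x (O.eq u v) = true ↔ f u = f v := by
  rw [P.sem_or (O.kind_eq u v), O.srcs_eq]
  simp only [mem_image, mem_univ, true_and]
  constructor
  · rintro ⟨_, ⟨c, rfl⟩, hw⟩
    rw [wval_inr, O.sem_pr hval] at hw
    rw [hw.1, hw.2]
  · intro heq
    refine ⟨_, ⟨⟨f u, hf u⟩, rfl⟩, ?_⟩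
    rw [wval_inr, O.sem_pr hval]
    exact ⟨rfl, heq.symm⟩

end ValOrd

/-! ### Refinement with value read-out -/

namespace RefVal

variable (RV : RefVal P V N T D)

/-- **Interpretation data**: the membership wires read the block `A`, the adjacency wires the graph, the initial
order/kernel wires the colouring `col₀` on the block. [folklore] -/
structure Reads (x : ι → Bool) (G : SimpleGraph V) (A : Finset V) (col₀ : V → ℕ) : Prop where
  /-- membership -/
  mem_iff : ∀ u, wval x (P.sem x) (RV.RI.mem u) = true ↔ u ∈ A
  /-- adjacency -/
  adj_iff : ∀ a b, wval x (P.sem x) (RV.RI.adj a b) = true ↔ G.Adj a b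
  /-- initial order on the block -/
  lt0_iff : ∀ a ∈ A, ∀ b ∈ A, wval x (P.sem x) (RV.RI.lt0 a b) = true ↔ col₀ a < col₀ b
  /-- initial kernel on the block -/
  eq0_iff : ∀ a ∈ A, ∀ b ∈ A, wval x (P.sem x) (RV.RI.eq0 a b) = true ↔ col₀ a = col₀ b

variable {RV} {A : Finset V} {col₀ : V → ℕ}

omit [DecidableEq V] [DecidableRel G.Adj] in
/-- The part of the refinement module is the block. [folklore] -/
theorem part_eq (h : RV.Reads x G A col₀) : RV.RI.part x = A := by
  ext u; unfold RefineIter.part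
  simp only [mem_filter, mem_univ, true_and]
  exact h.mem_iff u

omit [DecidableEq V] [DecidableRel G.Adj] in
/-- The refinement module reads the induced data. [folklore] -/
theorem reads₀ (h : RV.Reads x G A col₀) :
    RefineIter.Reads₀ RV.RI x (G.induce ((RV.RI.part x : Finset V) : Set V)) (fun a => col₀ a) where
  adj_iff a b := h.adj_iff a b
  lt0_iff a b := h.lt0_iff a (part_eq h ▸ a.2) b (part_eq h ▸ b.2)
  eq0_iff a b := h.eq0_iff a (part_eq h ▸ a.2) b (part_eq h ▸ b.2)

/-- **The final order wires read `refineIn` on the block.** [folklore] -/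
theorem sem_ltL_iff (h : RV.Reads x G A col₀) (hN : A.card ≤ N) (hT : A.card ≤ T + 1) {a b : V} (ha : a ∈ A) (hb : b ∈ A) :
    wval x (P.sem x) (RV.RI.ltW (Fin.last T) a b) = true ↔ BranchSum.refineIn G A col₀ a < BranchSum.refineIn G A col₀ b := by
  have hpart := part_eq h
  have key : ∀ (W : Finset V), W = A → ∀ (ha' : a ∈ W) (hb' : b ∈ W),
      (ocrIter (G.induce (W : Set V)) (fun z : ↥(W : Set V) => col₀ z) T ⟨a, mem_coe.2 ha'⟩ <
        ocrIter (G.induce (W : Set V)) (fun z : ↥(W : Set V) => col₀ z) T ⟨b, mem_coe.2 hb'⟩ ↔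
      BranchSum.refineIn G A col₀ a < BranchSum.refineIn G A col₀ b) := by
    rintro W rfl ha' hb'
    exact ReplayIter.ocrIter_T_lt_iff_refineIn _ hT ha' hb'
  rw [← key (RV.RI.part x) hpart (hpart ▸ ha) (hpart ▸ hb)]
  exact RefineIter.sem_ltW_iff (reads₀ h) (by rw [hpart]; exact hN) (Fin.last T) ⟨a, hpart ▸ ha⟩ ⟨b, hpart ▸ hb⟩

/-- **The final kernel wires read `refineIn` on the block.** [folklore] -/
theorem sem_eqL_iff (h : RV.Reads x G A col₀) (hN : A.card ≤ N) (hT : A.card ≤ T + 1) {a b : V} (ha : a ∈ A) (hb : b ∈ A) :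
    wval x (P.sem x) (RV.RI.eqW (Fin.last T) a b) = true ↔ BranchSum.refineIn G A col₀ a = BranchSum.refineIn G A col₀ b := by
  have hpart := part_eq h
  have key : ∀ (W : Finset V), W = A → ∀ (ha' : a ∈ W) (hb' : b ∈ W),
      (ocrIter (G.induce (W : Set V)) (fun z : ↥(W : Set V) => col₀ z) T ⟨a, mem_coe.2 ha'⟩ =
        ocrIter (G.induce (W : Set V)) (fun z : ↥(W : Set V) => col₀ z) T ⟨b, mem_coe.2 hb'⟩ ↔
      BranchSum.refineIn G A col₀ a = BranchSum.refineIn G A col₀ b) := by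
    rintro W rfl ha' hb'
    exact ReplayIter.ocrIter_T_eq_iff_refineIn _ hT ha' hb'
  rw [← key (RV.RI.part x) hpart (hpart ▸ ha) (hpart ▸ hb)]
  exact RefineIter.sem_eqW_iff (reads₀ h) (by rw [hpart]; exact hN) (Fin.last T) ⟨a, hpart ▸ ha⟩ ⟨b, hpart ▸ hb⟩

/-- The `c` gates: `w` is a block vertex below `v` (for `v` in the block). [folklore] -/
theorem sem_c_iff (h : RV.Reads x G A col₀) (hN : A.card ≤ N) (hT : A.card ≤ T + 1) {v : V} (hv : v ∈ A) (w : V) :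
    P.sem x (RV.c w v) = true ↔ w ∈ A ∧ BranchSum.refineIn G A col₀ w < BranchSum.refineIn G A col₀ v := by
  rw [P.sem_and (RV.kind_c w v), RV.srcs_c]
  simp only [mem_insert, mem_singleton, forall_eq_or_imp, forall_eq, h.mem_iff]
  constructor
  · rintro ⟨hw, hlt⟩; exact ⟨hw, (sem_ltL_iff h hN hT hw hv).1 hlt⟩
  · rintro ⟨hw, hlt⟩; exact ⟨hw, (sem_ltL_iff h hN hT hw hv).2 hlt⟩

/-- The count of `c · v` is the `refineIn` value of `v` (for `v` in the block). [folklore] -/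
theorem trueCount_c (h : RV.Reads x G A col₀) (hN : A.card ≤ N) (hT : A.card ≤ T + 1) {v : V} (hv : v ∈ A) :
    P.trueCount x (univ.image fun w => Sum.inr (RV.c w v)) = BranchSum.refineIn G A col₀ v := by
  rw [Switching.trueCount_image (P := P) (x := x) (f := fun w => RV.c w v) (RV.c_injective v),
    BranchSum.refineIn_eq_card_lt col₀ hv]
  congr 1
  ext w
  simp only [mem_filter, mem_univ, true_and, sem_c_iff h hN hT hv]

/-- The `ge` gates (for `v` in the block). [folklore] -/
theorem sem_ge_iff (h : RV.Reads x G A col₀) (hN : A.card ≤ N) (hT : A.card ≤ T + 1) {v : V} (hv : v ∈ A) (t : Fin (D + 1)) :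
    P.sem x (RV.ge v t) = true ↔ (t : ℕ) ≤ BranchSum.refineIn G A col₀ v := by
  rw [P.sem_atLeast_trueCount (RV.kind_ge v t) (RV.srcs_ge v t), trueCount_c h hN hT hv]

/-- The `inA` gates: `v` is a block vertex of value `t`. [folklore] -/
theorem sem_inA_iff (h : RV.Reads x G A col₀) (hN : A.card ≤ N) (hT : A.card ≤ T + 1) (v : V) (t : Fin D) :
    P.sem x (RV.inA v t) = true ↔ v ∈ A ∧ BranchSum.refineIn G A col₀ v = t := by
  rw [P.sem_and (RV.kind_inA v t), RV.srcs_inA]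
  simp only [mem_insert, mem_singleton, forall_eq_or_imp, forall_eq, h.mem_iff, wval_inr,
    P.sem_nor_singleton (RV.kind_nge v _) (RV.srcs_nge v _), Bool.not_eq_true']
  constructor
  · rintro ⟨hv, hge, hnge⟩
    rw [sem_ge_iff h hN hT hv] at hge
    have hlt : ¬ ((t.succ : Fin (D + 1)) : ℕ) ≤ BranchSum.refineIn G A col₀ v := fun h' => by
      rw [(sem_ge_iff h hN hT hv t.succ).2 h'] at hnge; exact Bool.noConfusion hnge
    simp only [Fin.val_castSucc, Fin.val_succ] at hge hlt
    exact ⟨hv, by omega⟩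
  · rintro ⟨hv, ht⟩
    refine ⟨hv, (sem_ge_iff h hN hT hv _).2 (by simp [ht]), ?_⟩
    cases hs : P.sem x (RV.ge v t.succ)
    · rfl
    · rw [sem_ge_iff h hN hT hv] at hs
      simp only [Fin.val_succ] at hs
      omega

/-- **The value wires read `refineIn` on every vertex.** [folklore] -/
theorem sem_val_iff (h : RV.Reads x G A col₀) (hN : A.card ≤ N) (hT : A.card ≤ T + 1) (v : V) (t : Fin D) :
    P.sem x (RV.val v t) = true ↔ BranchSum.refineIn G A col₀ v = t := by
  rw [P.sem_or (RV.kind_val v t), RV.srcs_val]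
  by_cases hv : v ∈ A
  · have hnm : P.sem x (RV.nm v) = false := by
      rw [P.sem_nor_singleton (RV.kind_nm v) (RV.srcs_nm v), Bool.not_eq_false', h.mem_iff]; exact hv
    split_ifs with ht
    · simp only [mem_insert, mem_singleton, exists_eq_or_imp, exists_eq_left, wval_inr, sem_inA_iff h hN hT, hnm]
      simp [hv]
    · simp only [mem_singleton, exists_eq_left, wval_inr, sem_inA_iff h hN hT]
      simp [hv]
  · have hnm : P.sem x (RV.nm v) = true := by
      rw [P.sem_nor_singleton (RV.kind_nm v) (RV.srcs_nm v), Bool.not_eq_true', Bool.eq_false_iff, ne_eq, h.mem_iff]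
      exact hv
    have h0 : BranchSum.refineIn G A col₀ v = 0 := by unfold BranchSum.refineIn; rw [dif_neg hv]
    split_ifs with ht
    · simp only [mem_insert, mem_singleton, exists_eq_or_imp, exists_eq_left, wval_inr, sem_inA_iff h hN hT, hnm]
      simp [hv, h0, ht]
    · simp only [mem_singleton, exists_eq_left, wval_inr, sem_inA_iff h hN hT]
      simp only [hv, false_and, false_iff, h0]
      exact fun h' => ht (by rw [← h'])

end RefVal

end Summit.PneNP.PneNP.Theorems
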